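import Summits.MatrixMultiplication.OmegaCensus.ThreeSetLineCertificate
import Summits.MatrixMultiplication.OmegaCensus.ThreeSetZ5Z5CoverKitC
import Summits.MatrixMultiplication.OmegaCensus.ThreeSetZ5LineTable6A
import Summits.MatrixMultiplication.OmegaCensus.ThreeSetZ5LineTable6B
import Summits.MatrixMultiplication.OmegaCensus.ThreeSetZ5Z5Trees6
import HarnessLib

/-!
# The three-set `ℤ₅ × ℤ₅` cover for parts `3` and `6`: line images of `W`, the certified-direction predicate, table checks

ω-census `pub-omega`, family (b3), seat pub-omega-group gen 36.  Framing: lottery ticket; floor = certified bounds/negative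
ranges.  VALUE: finite kernel data checks behind `ThreeSetZ5Z5Cells36.lean` (no cube symmetric form with `|W| = 3`,
`|X| = 6` over any odd-order `A ↠ ℤ₅ × ℤ₅`); NOT progress on ω.

Setting (`W = {0, e₁, e₂}` normalised in `ℤ₅²`; points `pt 5 i`, directions `j ≤ 5` of `DominoZpZpKit`: `u₁`, `u₂`, `u₁+u₂`,
`2u₁+u₂`, `3u₁+u₂`, `4u₁+u₂`):
* `wvec j` — the count vector of the line image of `W` in direction `j` (`001, 001, 011, 012, 013, 014`); `T6 j` — the
  certified line table of that image (`ThreeSetZ5LineTable6A/B.lean`);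
* `lineMat3Nat`, `annOKNat`, `exclOK` — PURE-`ℕ` twins of the three-set line matrix and of the two halves of `lineCert3At`
  (the `ZMod`/`Finset` form is ≈ 50× slower in the kernel); bridges `lineMat3_vecFn`, `lineCert3At_of_nat`;
* `ann6_001 … ann6_014` — the hole-independent annihilation half, decided ONCE per table; `cert6 σ j c` — "some entry of
  `T6 j` has key `c` and excludes the hole value `pv 5 j σ`" (the cheap per-hole predicate of the soundness checks
  `soundChk3 5 6 (tree6 σ) (cert6 σ)` in `ThreeSetZ5Z5Cover6A….lean`); **`lineCert3At_of_cert6`** — a passing `lineCert3At`.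
Everything here is re-checked by the kernel; the tables and trees are untrusted data.
-/

namespace Summit.MatrixMultiplication.OmegaCensus

namespace Z5Z5ThreeSet

open Finset ZpZpDomino

/-- Count vector of the line image of `W = {(0,0), (1,0), (0,1)}` in direction `j ≤ 5` (`j = 0`: `u₁`; `j = k+1`: `k·u₁ + u₂`).
[folklore] -/
def wvec (j : ℕ) : List ℕ :=
  if j ≤ 1 then [2, 1, 0, 0, 0] else if j = 2 then [1, 2, 0, 0, 0] else if j = 3 then [1, 1, 1, 0, 0]
  else if j = 4 then [1, 1, 0, 1, 0] else [1, 1, 0, 0, 1]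

/-- The certified line table of direction `j ≤ 5` for `|X| = 6`. [folklore] -/
def T6 (j : ℕ) : List (List ℕ × List (ℕ × List ℕ)) :=
  if j ≤ 1 then table6_001 else if j = 2 then table6_011 else if j = 3 then table6_012
  else if j = 4 then table6_013 else table6_014

/-! ## Pure-`ℕ` twins of the certificate checks -/

/-- The three-set line matrix over `ZMod 5` in pure `ℕ` arithmetic (indices `< 5`). [folklore] -/
def lineMat3Nat (W F : List ℕ) (τ u : ℕ) : ℕ :=
  ((List.range 5).map fun v => W.getD v 0 *
    (F.getD ((τ + v + 5 - u) % 5) 0 + F.getD ((v + u + 5 - τ) % 5) 0 + F.getD ((τ + u + 5 - v) % 5) 0)).sum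

/-- A sum over `ZMod 5` through `val` is a list sum over `range 5`. [folklore] -/
theorem sum_zmod5_val (g : ℕ → ℕ) : ∑ v : ZMod 5, g v.val = ((List.range 5).map g).sum := by
  have h : ((List.range 5).map g).sum = g 0 + g 1 + g 2 + g 3 + g 4 := by
    simp [List.range_succ, add_assoc]
  rw [h]
  exact Fin.sum_univ_five (fun v : Fin 5 => g v.val)

/-- **Bridge**: `lineMat3` of list data is `lineMat3Nat`. [folklore] -/
theorem lineMat3_vecFn (W F : List ℕ) (τ u : ZMod 5) :
    lineMat3 (vecFn W) (vecFn F) τ u = lineMat3Nat W F τ.val u.val := by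
  have i1 : ∀ τ u v : ZMod 5, (τ - u + v).val = (τ.val + v.val + 5 - u.val) % 5 := by decide
  have i2 : ∀ τ u v : ZMod 5, (v + u - τ).val = (v.val + u.val + 5 - τ.val) % 5 := by decide
  unfold lineMat3 vecFn lineMat3Nat
  simp only [i1, i2]
  exact sum_zmod5_val (fun n => W.getD n 0 *
    (F.getD ((τ.val + n + 5 - u.val) % 5) 0 + F.getD ((n + u.val + 5 - τ.val) % 5) 0 + F.getD ((τ.val + u.val + 5 - n) % 5) 0))

/-- Annihilation half of `lineCert3At` (`q = 5`) in pure `ℕ`: every `(N, z) ∈ certs` has `Σ_τ z(τ)·M(τ,u) ≡ 0 (mod N)`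
for all `u < 5`. [folklore] -/
def annOKNat (W F : List ℕ) (certs : List (ℕ × List ℕ)) : Bool :=
  certs.all fun c => (List.range 5).all fun u =>
    (((List.range 5).map fun τ => c.2.getD τ 0 * lineMat3Nat W F τ u).sum % c.1) == 0

/-- Exclusion half at hole value `v < 5` (pure list arithmetic): some `(N, z) ∈ certs` of length `5` has
`Σ z ≢ 5·z(v) (mod N)`. [folklore] -/
def exclOK (certs : List (ℕ × List ℕ)) (v : ℕ) : Bool :=
  certs.any fun c => c.2.length == 5 && ((c.2.sum % c.1) != (5 * c.2.getD v 0 % c.1))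

/-- A sum over `ZMod 5` of the entries of a list of length `5` is the list sum. [folklore] -/
theorem sum_getD_val_eq_sum (l : List ℕ) (hl : l.length = 5) : ∑ τ : ZMod 5, l.getD τ.val 0 = l.sum := by
  rw [sum_zmod5_val (fun n => l.getD n 0)]
  match l, hl with
  | [a, b, c, d, e], _ => simp [List.range_succ]

/-- **The two `ℕ` halves give `lineCert3At`.** [folklore] -/
theorem lineCert3At_of_nat {W F : List ℕ} {certs : List (ℕ × List ℕ)} {v : ℕ} (hv : v < 5)
    (h1 : annOKNat W F certs = true) (h2 : exclOK certs v = true) :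
    lineCert3At 5 (vecFn W) (vecFn F) certs ((v : ℕ) : ZMod 5) = true := by
  unfold lineCert3At
  rw [decide_eq_true_iff]
  constructor
  · intro c hc u
    simp only [annOKNat, List.all_eq_true, List.mem_range, beq_iff_eq] at h1
    have h := h1 c hc u.val (ZMod.val_lt u)
    have e : ∑ τ : ZMod 5, c.2.getD τ.val 0 * lineMat3 (vecFn W) (vecFn F) τ u =
        ((List.range 5).map fun τ => c.2.getD τ 0 * lineMat3Nat W F τ u.val).sum := by
      rw [← sum_zmod5_val (fun n => c.2.getD n 0 * lineMat3Nat W F n u.val)]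
      exact Finset.sum_congr rfl fun τ _ => by rw [lineMat3_vecFn]
    rw [e]
    exact h
  · simp only [exclOK, List.any_eq_true, Bool.and_eq_true, beq_iff_eq, bne_iff_ne, ne_eq] at h2
    obtain ⟨c, hc, hlen, hne⟩ := h2
    refine ⟨c, hc, ?_⟩
    rw [sum_getD_val_eq_sum c.2 hlen, ZMod.val_natCast, Nat.mod_eq_of_lt hv]
    exact hne

/-! ## The certified-direction predicate and the table checks -/

/-- **Certified-direction predicate** for hole position `σ` (point `pt 5 σ`), cheap form: some entry of `T6 j` has key `c` and
excludes the hole value `pv 5 j σ`. [folklore] -/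
def cert6 (σ j : ℕ) (c : List ℕ) : Bool :=
  (T6 j).any fun e => e.1 == c && exclOK e.2 (pv 5 j σ)

/-- Table check: every entry of `table6_001` annihilates its line matrix (line image `001`). [folklore] -/
theorem ann6_001 : (table6_001.all fun e => annOKNat [2, 1, 0, 0, 0] e.1 e.2) = true := by decide +kernel

/-- Table check for `table6_011` (line image `011`). [folklore] -/
theorem ann6_011 : (table6_011.all fun e => annOKNat [1, 2, 0, 0, 0] e.1 e.2) = true := by decide +kernel

/-- Table check for `table6_012` (line image `012`). [folklore] -/
theorem ann6_012 : (table6_012.all fun e => annOKNat [1, 1, 1, 0, 0] e.1 e.2) = true := by decide +kernel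

/-- Table check for `table6_013` (line image `013`). [folklore] -/
theorem ann6_013 : (table6_013.all fun e => annOKNat [1, 1, 0, 1, 0] e.1 e.2) = true := by decide +kernel

/-- Table check for `table6_014` (line image `014`). [folklore] -/
theorem ann6_014 : (table6_014.all fun e => annOKNat [1, 1, 0, 0, 1] e.1 e.2) = true := by decide +kernel

/-- All table checks, indexed by the direction `j ≤ 5`. [folklore] -/
theorem ann6 (j : ℕ) (hj : j < 6) : ((T6 j).all fun e => annOKNat (wvec j) e.1 e.2) = true := by
  have h6 : j = 0 ∨ j = 1 ∨ j = 2 ∨ j = 3 ∨ j = 4 ∨ j = 5 := by omega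
  rcases h6 with rfl | rfl | rfl | rfl | rfl | rfl
  · exact ann6_001
  · exact ann6_001
  · exact ann6_011
  · exact ann6_012
  · exact ann6_013
  · exact ann6_014

/-- **From the cheap predicate to a passing certificate**: `cert6 σ j c` gives a certificate list passing `lineCert3At` for
the line image of `W` in direction `j`, the count vector `c`, and the hole value of direction `j`. [folklore] -/
theorem lineCert3At_of_cert6 {σ j : ℕ} (hj : j < 6) {c : List ℕ} (h : cert6 σ j c = true) :
    ∃ certs : List (ℕ × List ℕ), lineCert3At 5 (vecFn (wvec j)) (vecFn c) certs ((pv 5 j σ : ℕ) : ZMod 5) = true := by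
  simp only [cert6, List.any_eq_true, Bool.and_eq_true, beq_iff_eq] at h
  obtain ⟨e, he, h1, h2⟩ := h
  have ha := ann6 j hj
  rw [List.all_eq_true] at ha
  have h3 := ha e he
  rw [h1] at h3
  exact ⟨e.2, lineCert3At_of_nat (pv_lt 5 j σ) h3 h2⟩

end Z5Z5ThreeSet

end Summit.MatrixMultiplication.OmegaCensus
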